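import Mathlib

/-!
# Stub `stub_twoLoopAdmissible` (calculus A) for line `Sketch` of crux `FemtoCurvatureTwoPointC`

Pure real analysis. The explicit closed-form two-loop asymptotic-freedom coupling
`u L β = (ψ (T L β))⁻¹` with
`T L β = y - q · log (y + q) - 2 b₀ · log (L / 8)`, `y = max (κ β + c₀) 1`, and the profile
`ψ t = (1 + q) · exp (min t 0) + max t 0 + q · (log (max t 0 + e) - 1)`
is admissible: positive everywhere, continuous in `β` on every torus `L`, and freezing
(`u L β → 0` as `β → ∞`) on every fixed torus.

* positivity: `ψ t ≥ (1 + q) · exp (min t 0) > 0`, the other two summands being nonnegative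
  (`log (max t 0 + e) ≥ log e = 1`, `q ≥ 0`);
* continuity: every logarithm has argument `≥ 1`, and `ψ ∘ T L` never vanishes;
* freezing: `y → ∞` (`κ > 0`) and `x - q · log x → ∞` (`log = o(id)`), so `T L · → ∞`; moreover
  `ψ t ≥ t`, whence `ψ ∘ T L → ∞` and `u L = (ψ ∘ T L)⁻¹ → 0`.
-/

set_option autoImplicit false

open Filter Topology

namespace Summit.QuantumFields.YangMills.Theorems.FemtoCurvatureTwoPointC

/-- The two-loop profile `ψ t = (1 + q) · exp (min t 0) + max t 0 + q · (log (max t 0 + e) - 1)`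
strictly dominates `max t 0` when `q ≥ 0`. -/
theorem twoLoopAdm_max_lt_psi (q : ℝ) (hq : 0 ≤ q) (t : ℝ) :
    max t 0 < (1 + q) * Real.exp (min t 0) + max t 0 +
      q * (Real.log (max t 0 + Real.exp 1) - 1) := by
  have h1 : 0 < (1 + q) * Real.exp (min t 0) := mul_pos (by linarith) (Real.exp_pos _)
  have h2 : 1 ≤ Real.log (max t 0 + Real.exp 1) :=
    calc (1 : ℝ) = Real.log (Real.exp 1) := (Real.log_exp 1).symm
      _ ≤ Real.log (max t 0 + Real.exp 1) :=
        Real.log_le_log (Real.exp_pos 1) (le_add_of_nonneg_left (le_max_right _ _))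
  have h3 : 0 ≤ q * (Real.log (max t 0 + Real.exp 1) - 1) := mul_nonneg hq (by linarith)
  linarith

/-- The two-loop profile `ψ` is positive when `q ≥ 0`. -/
theorem twoLoopAdm_psi_pos (q : ℝ) (hq : 0 ≤ q) (t : ℝ) :
    0 < (1 + q) * Real.exp (min t 0) + max t 0 +
      q * (Real.log (max t 0 + Real.exp 1) - 1) :=
  (le_max_right t 0).trans_lt (twoLoopAdm_max_lt_psi q hq t)

/-- The two-loop profile `ψ` is continuous. -/
theorem twoLoopAdm_psi_continuous (q : ℝ) :
    Continuous fun t : ℝ => (1 + q) * Real.exp (min t 0) + max t 0 +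
      q * (Real.log (max t 0 + Real.exp 1) - 1) := by
  have hm : Continuous fun t : ℝ => max t 0 := continuous_id.max continuous_const
  exact ((continuous_const.mul (Real.continuous_exp.comp (continuous_id.min continuous_const))).add
    hm).add (continuous_const.mul (((hm.add continuous_const).log fun t =>
      (add_pos_of_nonneg_of_pos (le_max_right t 0) (Real.exp_pos 1)).ne').sub continuous_const))

/-- The two-loop profile `ψ` tends to `+∞` at `+∞` when `q ≥ 0` (it dominates `t`). -/
theorem twoLoopAdm_psi_tendsto_atTop (q : ℝ) (hq : 0 ≤ q) :
    Tendsto (fun t : ℝ => (1 + q) * Real.exp (min t 0) + max t 0 +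
      q * (Real.log (max t 0 + Real.exp 1) - 1)) atTop atTop :=
  tendsto_atTop_mono (fun t => (le_max_left t 0).trans (twoLoopAdm_max_lt_psi q hq t).le)
    tendsto_id

/-- `x - q · log x → +∞` as `x → +∞`, since `log = o(id)` at `+∞`. -/
theorem twoLoopAdm_tendsto_sub_mul_log (q : ℝ) :
    Tendsto (fun x : ℝ => x - q * Real.log x) atTop atTop :=
  ((Asymptotics.IsEquivalent.refl (u := (id : ℝ → ℝ)) (l := atTop)).sub_isLittleO
    (Real.isLittleO_log_id_atTop.const_mul_left q)).symm.tendsto_atTop tendsto_id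

/-- The two-loop effective inverse temperature
`T L β = y - q · log (y + q) - 2 b₀ · log (L / 8)`, `y = max (κ β + c₀) 1`, is continuous in `β`
when `q ≥ 0` (the logarithm has argument `≥ 1`). -/
theorem twoLoopAdm_T_continuous (κ c₀ b₀ q : ℝ) (hq : 0 ≤ q) (L : ℕ) :
    Continuous fun β : ℝ => max (κ * β + c₀) 1 - q * Real.log (max (κ * β + c₀) 1 + q) -
      2 * b₀ * Real.log ((L : ℝ) / 8) := by
  have hy : Continuous fun β : ℝ => max (κ * β + c₀) 1 :=
    ((continuous_const.mul continuous_id).add continuous_const).max continuous_const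
  exact (hy.sub (continuous_const.mul ((hy.add continuous_const).log fun β =>
    (lt_of_lt_of_le one_pos (le_add_of_le_of_nonneg (le_max_right _ _) hq)).ne'))).sub
      continuous_const

/-- The two-loop effective inverse temperature `T L β` tends to `+∞` as `β → +∞` on every fixed
torus `L`, provided `κ > 0`. -/
theorem twoLoopAdm_T_tendsto_atTop (κ c₀ b₀ q : ℝ) (hκ : 0 < κ) (L : ℕ) :
    Tendsto (fun β : ℝ => max (κ * β + c₀) 1 - q * Real.log (max (κ * β + c₀) 1 + q) -
      2 * b₀ * Real.log ((L : ℝ) / 8)) atTop atTop := by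
  have hy : Tendsto (fun β : ℝ => max (κ * β + c₀) 1 + q) atTop atTop :=
    tendsto_atTop_add_const_right _ _ (tendsto_atTop_mono (fun β => le_max_left _ _)
      (tendsto_atTop_add_const_right _ _ (tendsto_id.const_mul_atTop hκ)))
  refine Tendsto.congr (fun β => ?_) (tendsto_atTop_add_const_right _
    (-q - 2 * b₀ * Real.log ((L : ℝ) / 8)) ((twoLoopAdm_tendsto_sub_mul_log q).comp hy))
  simp only [Function.comp_apply]
  ring

/-- **Calculus A** (admissibility of the explicit two-loop coupling). With
`T L β = y - q · log (y + q) - 2 b₀ · log (L / 8)`, `y = max (κ β + c₀) 1`, and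
`u L β = ((1 + q) · exp (min (T L β) 0) + max (T L β) 0 + q · (log (max (T L β) 0 + e) - 1))⁻¹`,
for `κ > 0` and `q ≥ 0` the coupling `u` is positive everywhere, continuous in `β` on every torus
`L`, and `u L β → 0` as `β → +∞` for every `L`. -/
theorem stub_twoLoopAdmissible :
    ∀ (κ c₀ b₀ q : ℝ), 0 < κ → 0 ≤ q →
      ∀ (T u : ℕ → ℝ → ℝ),
        (T = fun (L : ℕ) (β : ℝ) => max (κ * β + c₀) 1 - q * Real.log (max (κ * β + c₀) 1 + q) -
            2 * b₀ * Real.log ((L : ℝ) / 8)) →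
        (u = fun (L : ℕ) (β : ℝ) => ((1 + q) * Real.exp (min (T L β) 0) + max (T L β) 0 +
            q * (Real.log (max (T L β) 0 + Real.exp 1) - 1))⁻¹) →
        (∀ (L : ℕ) (β : ℝ), 0 < u L β) ∧ (∀ L : ℕ, Continuous (u L)) ∧
          (∀ L : ℕ, Filter.Tendsto (u L) Filter.atTop (nhds 0)) := by
  rintro κ c₀ b₀ q hκ hq T u rfl rfl
  refine ⟨fun L β => inv_pos.2 (twoLoopAdm_psi_pos q hq _), fun L => ?_, fun L => ?_⟩
  · exact ((twoLoopAdm_psi_continuous q).comp (twoLoopAdm_T_continuous κ c₀ b₀ q hq L)).inv₀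
      fun β => (twoLoopAdm_psi_pos q hq _).ne'
  · exact ((twoLoopAdm_psi_tendsto_atTop q hq).comp
      (twoLoopAdm_T_tendsto_atTop κ c₀ b₀ q hκ L)).inv_tendsto_atTop

end Summit.QuantumFields.YangMills.Theorems.FemtoCurvatureTwoPointC
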